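import Summits.ResolutionOfSingularities.ResolutionOfSingularities.Theorems.MarkedTransferCampaignW46HonestResolution
import Summits.ResolutionOfSingularities.ResolutionOfSingularities.Theorems.MarkedTransferCampaignW46ThreefoldsGammaFreeGlobalFamilyStep
import Summits.ResolutionOfSingularities.ResolutionOfSingularities.Theorems.MarkedTransferCampaignW46ThreefoldsGammaFreeGlobalMeasureSums
import Literature.AlgebraicGeometry.Resolution.QuasiExcellentSchemes
import Literature.AlgebraicGeometry.Hironaka2017.Proofs.S16Proof.Thm16p14DimOne
import HarnessLib

/-!
# [OURS · L1 W4.6 rung (i-h)] GOOD PROCRASTINATIONS: blowing up a singular point of a singular curve of `Sing(E)` is a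
# §2.1-permissible step that lowers the total `δ`-invariant of the prime divisors of `V(J)` (cell res-hironaka,
# LADDER-RESOLUTION rung L, D-0089; campaign s46, prover res-L1-s46-pv-1; host route MarkedTransfer,
# `--supports stmt-ResolutionOfSingularities-16155`)

HONEST FRAMING. Nothing here is a statement of H. Hironaka's manuscript (2017-03-23, [Hironaka2017]) and nothing here
asserts that any statement of it holds. OURS objects and tree geometry only; résumé-free (no notion instance, no `Inv`).
AI-written; weaker than expert review. No `sorry`; axioms standard.

## Why (complement to rungs (i-f)/(i-g))

Rung (i-g) (`exists_honestReaches_resolved`, p536234) resolves a standard ideal exponent `E = (J, b)` on a surface over a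
perfect field by HONEST steps, in the class `Regime.singCurvesRegular` («every curve of `Sing(E)` is regular»). Outside that
class the honest procedure stalls: a singular curve of `Sing(E)` is not a permissible centre and every point of it
procrastinates. PHASE 0 of OUR procedure repairs this by GOOD PROCRASTINATIONS: blow up a closed point of `Sing(E)` at
which a curve of `Sing(E)` is singular. This file proves that such a step is §2.1-permissible, keeps the state a standard
surface state, and STRICTLY LOWERS the measure `Δ = Σ_{ζ} Σ_y δ(𝒪_{C_ζ,y})` — the total `δ`-invariant of the prime divisors
`C_ζ` of `V(J)` (Kollár 2007 §1.4; Hartshorne V.3.8/3.9: embedded resolution of curves in surfaces) — re-using the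
surface bookkeeping of rung (ii-2) (res-L1-s46-pv-11: `exists_family_pointBlowup`, `familyDelta_lt_of_inl_le`,
`exists_primeDivisorFamily`). Companion `…PermissibleResolution` concludes: EVERY standard ideal exponent on a surface over a
perfect field is resolved by finitely many §2.1-permissible blow-ups.

## Contents

* `PermissibleReaches` — reachability by finitely many §2.1-permissible steps (any centres); `trans`, `of_honestReaches`.
* **`exists_permissibleReaches_resolved`** — RUNG (i-h): every standard ideal exponent on a surface over a perfect field
  `K : Type` is resolved (`Sing = ∅`) after finitely many §2.1-permissible blow-ups (induction on `Δ`, then rung (i-g)).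
* `coheight_eq_one_of_not_isClosed_of_ne_genericPoint`, `mem_divisorialPoints_of_mem_sing` — on a surface the non-closed
  points of `Sing(E)` are prime divisors of `V(J)`.
* `HasCurveFamily Z J n` — «the prime divisors of `V(J)` are presented by a finite family of integral curves of total
  `δ`-invariant `n`» (the shape of rung (ii-2)'s brick B10a); `exists_hasCurveFamily`.
* `singCurvesRegular_of_family` — if every member of the family through `Sing(E)` is regular, `E` is in the class of (i-g).
* **`exists_goodProcrastination`** — THE STEP: from a family with a singular member through `Sing(E)`, a §2.1-permissible
  point blow-up to a standard surface state with a family of smaller total `δ`.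

## References

* J. Kollár, Lectures on Resolution of Singularities (2007), §1.4, Thm. 1.47. [Kollar2007]
* R. Hartshorne, Algebraic Geometry (1977), Ch. V Prop. 3.8, Thm. 3.9. [Hartshorne1977]
* Q. Liu, Algebraic Geometry and Arithmetic Curves (2002), §9.2.4 Lemma 2.32, Thm. 8.1.19. [Liu2002]
* H. Hironaka, ms. 2017-03-23, §2.1 p.4 l.34–39, Def. 2.1 p.5, Th. 16.13 p.87 l.26–28 — scope only (the ROLE of the
  resolution clause is replaced by OUR procedure), under adjudication, not cited as fact. [Hironaka2017]
-/

noncomputable section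

set_option linter.dupNamespace false -- mandated namespace of this single-conjunct summit

open CategoryTheory AlgebraicGeometry TopologicalSpace IsLocalRing

namespace Summit.ResolutionOfSingularities.ResolutionOfSingularities.Theorems

namespace CampaignW46

open Literature.AlgebraicGeometry.Resolution
open Literature.AlgebraicGeometry.Hironaka2017.S02Preliminaries
open Literature.AlgebraicGeometry.Hironaka2017.Datum
open Scheme.IdealSheafData

universe u

variable {p : ℕ} [Fact p.Prime] {K : Type u} [Field K] [CharP K p]

/-! ## Reachability by §2.1-permissible steps -/

/-- [OURS · L1 W4.6 rung (i-h)] NOT a statement of the manuscript. **`(A, E)` is reached from `(A₀, E₀)` by finitely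
many §2.1-permissible steps** (transforms of Def. 2.1 along blowings up of permissible centres, ANY such centres —
procrastinating or not), over the same base field. [folklore] -/
inductive PermissibleReaches (A₀ : AmbientDatum p K) (E₀ : IdealExponent A₀.Z) :
    ∀ A : AmbientDatum p K, IdealExponent A.Z → Prop
  | refl : PermissibleReaches A₀ E₀ A₀ E₀
  | step {A : AmbientDatum p K} {E : IdealExponent A.Z} {A' : AmbientDatum p K} (D : Closeds A.Z) (π : A'.Z ⟶ A.Z)
      (h : PermissibleReaches A₀ E₀ A E) (hD : E.IsPermissibleCentre A.hom D) (hhom : A'.hom = π ≫ A.hom)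
      (hπ : IsBlowup π (vanishingIdeal D)) : PermissibleReaches A₀ E₀ A' (E.transform π D)

namespace PermissibleReaches

variable {A₀ : AmbientDatum p K} {E₀ : IdealExponent A₀.Z}

/-- Transitivity. [folklore] -/
theorem trans {A₁ : AmbientDatum p K} {E₁ : IdealExponent A₁.Z} (h₁ : PermissibleReaches A₀ E₀ A₁ E₁)
    {A₂ : AmbientDatum p K} {E₂ : IdealExponent A₂.Z} (h₂ : PermissibleReaches A₁ E₁ A₂ E₂) :
    PermissibleReaches A₀ E₀ A₂ E₂ := by
  induction h₂ with
  | refl => exact h₁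
  | step D π _ hD hhom hπ ih => exact ih.step D π hD hhom hπ

/-- Honest steps are permissible steps. [folklore] -/
theorem of_honestReaches {A : AmbientDatum p K} {E : IdealExponent A.Z} (h : HonestReaches A₀ E₀ A E) :
    PermissibleReaches A₀ E₀ A E := by
  induction h with
  | refl => exact refl
  | step D π _ hD _ hhom hπ ih => exact ih.step D π hD hhom hπ

/-- A single step, prepended. [folklore] -/
theorem head {A' : AmbientDatum p K} (D : Closeds A₀.Z) (π : A'.Z ⟶ A₀.Z) (hD : E₀.IsPermissibleCentre A₀.hom D)
    (hhom : A'.hom = π ≫ A₀.hom) (hπ : IsBlowup π (vanishingIdeal D)) {A : AmbientDatum p K}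
    {E : IdealExponent A.Z} (h : PermissibleReaches A' (E₀.transform π D) A E) : PermissibleReaches A₀ E₀ A E :=
  (refl.step D π hD hhom hπ).trans h

end PermissibleReaches

/-! ## Codimension bookkeeping on a surface -/

/-- On an integral scheme of dimension `≤ 2`, a non-closed point other than the generic point has codimension one.
[folklore] -/
theorem coheight_eq_one_of_not_isClosed_of_ne_genericPoint {Z : Scheme.{u}} [IsIntegral Z]
    (hdimZ : topologicalKrullDim Z ≤ 2) {η : Z} (hgen : η ≠ genericPoint Z) (hncl : ¬ IsClosed ({η} : Set Z)) :
    Order.coheight η = 1 := by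
  have hne0 : Order.coheight η ≠ 0 := fun h0 => hgen (eq_genericPoint_of_coheight_eq_zero h0)
  obtain ⟨x, hxcl, hxne⟩ : ∃ x, x ∈ closure ({η} : Set Z) ∧ x ∉ ({η} : Set Z) := by
    have hss : ({η} : Set Z) ⊂ closure {η} :=
      subset_closure.ssubset_of_ne fun h => hncl (by rw [h]; exact isClosed_closure)
    exact Set.exists_of_ssubset hss
  rw [Set.mem_singleton_iff] at hxne
  have hsp : η ⤳ x := specializes_iff_mem_closure.mpr hxcl
  have hlt : x < η := lt_of_le_not_ge (Scheme.le_iff_specializes.mpr hsp) fun h' =>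
    hxne (Specializes.antisymm (Scheme.le_iff_specializes.mp h') hsp).eq
  have h1 : Order.coheight η + 1 ≤ Order.coheight x := Order.coheight_add_one_le hlt
  have h2 : ((Order.height x + Order.coheight x : ℕ∞) : WithBot ℕ∞) ≤ 2 :=
    (coe_height_add_coheight_le_topologicalKrullDim x).trans hdimZ
  have h3 : Order.height x + Order.coheight x ≤ 2 := WithBot.coe_le_coe.mp h2
  have h4 : Order.coheight η + 1 ≤ 2 := h1.trans (le_add_self.trans h3)
  have hfin : Order.coheight η ≠ ⊤ := by
    intro ht; rw [ht] at h4; simp at h4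
  obtain ⟨c, hc⟩ := ENat.ne_top_iff_exists.mp hfin
  rw [← hc] at h4 hne0 ⊢
  have h5 : c + 1 ≤ 2 := by exact_mod_cast h4
  have h6 : c ≠ 0 := fun h => hne0 (by rw [h]; rfl)
  have h7 : c = 1 := by omega
  rw [h7]; rfl

/-- A closed point in the closure of a non-closed point does not have codimension one (it lies strictly below a point
of positive codimension). [folklore] -/
theorem coheight_ne_one_of_isClosed_of_mem_closure {Z : Scheme.{u}} [IsIntegral Z] {η ξ : Z}
    (hgen : η ≠ genericPoint Z) (hncl : ¬ IsClosed ({η} : Set Z)) (hξ : IsClosed ({ξ} : Set Z))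
    (hmem : ξ ∈ closure ({η} : Set Z)) : Order.coheight ξ ≠ 1 := by
  have hne0 : Order.coheight η ≠ 0 := fun h0 => hgen (eq_genericPoint_of_coheight_eq_zero h0)
  have hξη : ξ ≠ η := fun h => hncl (h ▸ hξ)
  have hsp : η ⤳ ξ := specializes_iff_mem_closure.mpr hmem
  have hlt : ξ < η := lt_of_le_not_ge (Scheme.le_iff_specializes.mpr hsp) fun h' =>
    hξη (Specializes.antisymm (Scheme.le_iff_specializes.mp h') hsp).eq
  have h1 : Order.coheight η + 1 ≤ Order.coheight ξ := Order.coheight_add_one_le hlt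
  intro h
  rw [h] at h1
  by_cases htop : Order.coheight η = ⊤
  · rw [htop] at h1; simp at h1
  · exact hne0 (Order.lt_one_iff.mp ((ENat.add_one_le_iff htop).mp h1))

/-- **On a surface, the non-closed points of `Sing(E)` are prime divisors of `V(J)`** (`b ≥ 1`). [folklore] -/
theorem mem_divisorialPoints_of_mem_sing (A : AmbientDatum p K) {E : IdealExponent A.Z} (hE : E.IsStandard)
    (hdimZ : topologicalKrullDim A.Z ≤ 2) {η : A.Z} (hη : η ∈ E.sing) (hncl : ¬ IsClosed ({η} : Set A.Z)) :
    η ∈ divisorialPoints E.J := by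
  haveI := ambient_isIntegral A
  have hsupp : η ∈ (E.J.support : Set A.Z) := sing_le_support E hE.2 hη
  refine ⟨hsupp, coheight_eq_one_of_not_isClosed_of_ne_genericPoint hdimZ ?_ hncl⟩
  intro h
  rw [h] at hsupp
  exact not_mem_support_genericPoint hE.1 hsupp

/-! ## Families of integral curves presenting the prime divisors of `V(J)` -/

/-- [OURS · L1 W4.6 rung (i-h)] **The prime divisors of `V(J)` are presented by a finite family of integral Noetherian
quasi-excellent curves `i_k : C_k ↪ Z` (closed immersions, `i_k(η_{C_k})` running bijectively through the
codimension-one points of `V(J)`) of total `δ`-invariant `Σ_k Σ_y δ(𝒪_{C_k,y}) = n`** — the data shape of rung (ii-2)'s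
brick B10a (`exists_primeDivisorFamily`) with its measure `familyDelta`. [cite: Kollar2007, §1.4] -/
def HasCurveFamily (Z : Scheme.{u}) (J : Z.IdealSheafData) (n : ℕ∞) : Prop :=
  ∃ (ι : Type) (_ : Finite ι) (ζ : ι → Z) (C : ι → Scheme.{u}) (i : ∀ k, C k ⟶ Z)
    (hfam : ∀ k, IsClosedImmersion (i k) ∧ ∃ (_ : IsIntegral (C k)) (_ : IsNoetherian (C k)),
      Scheme.IsQuasiExcellent (C k) ∧ topologicalKrullDim (C k) ≤ 1 ∧ i k (genericPoint (C k)) = ζ k),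
    Function.Injective ζ ∧ Set.range ζ = divisorialPoints J ∧ @familyDelta ι C (fun k => (hfam k).2.1) = n

/-- **Every standard ideal exponent on a surface has a curve family** (rung (ii-2)'s brick B10a,
`exists_primeDivisorFamily`). [cite: StacksProject, Tag 0BE1] -/
theorem exists_hasCurveFamily (A : AmbientDatum p K) {E : IdealExponent A.Z} (hE : E.IsStandard)
    (hdimZ : topologicalKrullDim A.Z ≤ 2) : ∃ n, HasCurveFamily A.Z E.J n := by
  haveI := ambient_isIntegral A
  haveI := AmbientDatum.isNoetherian_ambient A
  have hXq : Scheme.IsQuasiExcellent A.Z := (AmbientDatum.isExcellent_Z A).isQuasiExcellent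
  obtain ⟨n, ζ, C, i, hinj, hrange, hfam⟩ := exists_primeDivisorFamily hXq hdimZ hE.1
  exact ⟨_, Fin n, inferInstance, ζ, C, i, hfam, hinj, hrange, rfl⟩

/-- **If every member of a curve family whose generic point is singular for `E` is a regular scheme, then `E` is in the
class of rung (i-g)** (`Regime.singCurvesRegular`): a curve of `Sing(E)` is the closure of a codimension-one point of
`V(J)`, i.e. the image of a member, and a closed immersion from a regular scheme is an isomorphism onto the reduced closed
subscheme on its image. [folklore] -/
theorem singCurvesRegular_of_family (A : AmbientDatum p K) {E : IdealExponent A.Z} (hE : E.IsStandard)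
    (hdimZ : topologicalKrullDim A.Z ≤ 2) {ι : Type} (ζ : ι → A.Z) (C : ι → Scheme.{u}) (i : ∀ k, C k ⟶ A.Z)
    (hfam : ∀ k, IsClosedImmersion (i k) ∧ ∃ (_ : IsIntegral (C k)) (_ : IsNoetherian (C k)),
      Scheme.IsQuasiExcellent (C k) ∧ topologicalKrullDim (C k) ≤ 1 ∧ i k (genericPoint (C k)) = ζ k)
    (hrange : Set.range ζ = divisorialPoints E.J)
    (hreg : ∀ k, ζ k ∈ E.sing → Scheme.IsRegular (C k)) : Regime.singCurvesRegular A E := by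
  intro η hηS hncl
  have hηdiv : η ∈ divisorialPoints E.J := mem_divisorialPoints_of_mem_sing A hE hdimZ hηS hncl
  rw [← hrange] at hηdiv
  obtain ⟨k, rfl⟩ := hηdiv
  haveI := (hfam k).1
  haveI := (hfam k).2.1
  have hgen : i k (genericPoint (C k)) = ζ k := (hfam k).2.2.2.2.2
  -- `C k ≅` the reduced closed subscheme on `closure {ζ k}` (its kernel is `𝓘_{cl ζ k}`)
  have hker : (primeDivisorIdeal (ζ k)).subschemeι.ker = (i k).ker := by
    rw [ker_subschemeι, ker_eq_primeDivisorIdeal_of_isIntegral (i k), hgen]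
  haveI := IsClosedImmersion.isIso_lift _ (i k) hker
  change Scheme.IsRegular (primeDivisorIdeal (ζ k)).subscheme
  exact Scheme.IsRegular.of_isOpenImmersion (inv (IsClosedImmersion.lift _ (i k) hker.le)) (hreg k hηS)

/-! ## The good procrastination -/

/-- [OURS · L1 W4.6 rung (i-h)] NOT a statement of the manuscript. **THE GOOD PROCRASTINATION.** Over a perfect field: let
`E` be a standard ideal exponent on an ambient datum `A` of dimension `≤ 2`, presented with a curve family
`(ζ, C, i)` of `V(J)`, and let the member `C_{k₀}` have its generic point in `Sing(E)` (a singular CURVE of `E`) and a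
singular point `c₀`. Then the closed point `ξ = i_{k₀}(c₀)` of `Sing(E)` is a §2.1-permissible centre; blowing it up gives
an ambient datum `A′` over the same field, of dimension `≤ 2`, on which the transform `E′` (Def. 2.1) is standard and
`V(J′)` has a curve family of STRICTLY SMALLER total `δ`-invariant (the strict transforms of the members, `δ` dropping at
`C_{k₀}` by Kollár §1.4 / Liu 9.2.32, plus the regular exceptional curve with `δ = 0`). [cite: Kollar2007, §1.4]
[cite: Hartshorne1977, Ch. V Prop. 3.8] -/
theorem exists_goodProcrastination [PerfectField K] (A : AmbientDatum p K) (E : IdealExponent A.Z) (hE : E.IsStandard)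
    (hdimZ : topologicalKrullDim A.Z ≤ 2) {ι : Type} [Finite ι] (ζ : ι → A.Z) (C : ι → Scheme.{u})
    (i : ∀ k, C k ⟶ A.Z) (hζinj : Function.Injective ζ) (hrange : Set.range ζ = divisorialPoints E.J)
    (hfam : ∀ k, IsClosedImmersion (i k) ∧ ∃ (_ : IsIntegral (C k)) (_ : IsNoetherian (C k)),
      Scheme.IsQuasiExcellent (C k) ∧ topologicalKrullDim (C k) ≤ 1 ∧ i k (genericPoint (C k)) = ζ k)
    {k₀ : ι} (hk₀ : ζ k₀ ∈ E.sing) {c₀ : C k₀} (hc₀ : c₀ ∉ Scheme.regularLocus (C k₀)) :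
    ∃ (A' : AmbientDatum p K) (D : Closeds A.Z) (π : A'.Z ⟶ A.Z),
      E.IsPermissibleCentre A.hom D ∧ A'.hom = π ≫ A.hom ∧ IsBlowup π (vanishingIdeal D) ∧
        (E.transform π D).IsStandard ∧ topologicalKrullDim A'.Z ≤ 2 ∧
          ∃ n', HasCurveFamily A'.Z (E.transform π D).J n' ∧ n' < @familyDelta ι C (fun k => (hfam k).2.1) := by
  classical
  haveI := ambient_isIntegral A
  haveI := AmbientDatum.isNoetherian_ambient A
  haveI : IsLocallyNoetherian A.Z := inferInstance
  have hZreg : Scheme.IsRegular A.Z := ambient_isRegular A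
  have hXq : Scheme.IsQuasiExcellent A.Z := (AmbientDatum.isExcellent_Z A).isQuasiExcellent
  haveI hci : ∀ k, IsClosedImmersion (i k) := fun k => (hfam k).1
  haveI hint : ∀ k, IsIntegral (C k) := fun k => (hfam k).2.1
  haveI hN : ∀ k, IsNoetherian (C k) := fun k => (hfam k).2.2.1
  have hCq : ∀ k, Scheme.IsQuasiExcellent (C k) := fun k => (hfam k).2.2.2.1
  have hCdim : ∀ k, topologicalKrullDim (C k) ≤ 1 := fun k => (hfam k).2.2.2.2.1
  have hgen : ∀ k, i k (genericPoint (C k)) = ζ k := fun k => (hfam k).2.2.2.2.2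
  -- the centre `ξ = i_{k₀}(c₀)`: a closed point of the singular curve `closure {ζ k₀} ⊆ Sing(E)`
  set ξ : A.Z := i k₀ c₀ with hξdef
  have hc₀cl : IsClosed ({c₀} : Set (C k₀)) :=
    isClosed_singleton_of_not_mem_regularLocus_of_dim_le_one (hCq k₀) (hCdim k₀) hc₀
  have hξcl : IsClosed ({ξ} : Set A.Z) := by
    rw [hξdef, ← Set.image_singleton]
    exact (i k₀).isClosedEmbedding.isClosedMap _ hc₀cl
  have hξmem : ξ ∈ closure ({ζ k₀} : Set A.Z) := by
    rw [← hgen k₀]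
    exact specializes_iff_mem_closure.mp ((specializes_iff_exists_eq_of_isClosedImmersion (i k₀) ξ).mpr ⟨c₀, rfl⟩)
  have hξS : ξ ∈ E.sing := (A.isClosed_sing E).closure_subset_iff.mpr (Set.singleton_subset_iff.mpr hk₀) hξmem
  have hζk₀ : ζ k₀ ∈ divisorialPoints E.J := hrange ▸ ⟨k₀, rfl⟩
  have hζgen : ζ k₀ ≠ genericPoint A.Z := fun h =>
    not_mem_support_genericPoint hE.1 (h ▸ hζk₀.1)
  have hζncl : ¬ IsClosed ({ζ k₀} : Set A.Z) := by
    intro hcl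
    -- a closed point of a surface has codimension `≠ 1`... but `ζ k₀` has codimension one: so `cl{ζ k₀} = {ζ k₀} ∋ ξ`,
    -- `ξ = ζ k₀ = i k₀ (η_{C k₀})`, `c₀` is the generic point of `C k₀`, a regular point — contradiction
    have hξeq : ξ = ζ k₀ := by
      have := hξmem; rw [hcl.closure_eq, Set.mem_singleton_iff] at this; exact this
    have hc₀gen : c₀ = genericPoint (C k₀) := (i k₀).isClosedEmbedding.injective (hξeq.trans (hgen k₀).symm)
    exact hc₀ (hc₀gen ▸ genericPoint_mem_regularLocus (C k₀))
  have hξdiv : ξ ∉ divisorialPoints E.J := fun h =>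
    coheight_ne_one_of_isClosed_of_mem_closure hζgen hζncl hξcl hξmem h.2
  have hD : E.IsPermissibleCentre A.hom ⟨{ξ}, hξcl⟩ :=
    Literature.AlgebraicGeometry.Hironaka2017.S16Proof.isPermissibleCentre_point A E hξcl hξS
  have hξne : ({ξ} : Set A.Z) ≠ Set.univ := ne_univ_of_subset_sing A hE hD.subset_sing
  -- blow up `ξ`
  obtain ⟨A', π, hhom, hπ, hst, hdim⟩ := exists_ambientBlowup A ⟨{ξ}, hξcl⟩
    (isRegular_subscheme_vanishingIdeal_singleton hξcl) hξne
  refine ⟨A', ⟨{ξ}, hξcl⟩, π, hD, hhom, hπ, hst E hE, hdim 2 hdimZ, ?_⟩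
  -- the new family (rung (ii-2), brick B8b/B10b bookkeeping)
  obtain ⟨ζ', C', i', hinj', hrange', hfam', hinl, hinr, hδ, hδE⟩ :=
    exists_family_pointBlowup hZreg hXq hdimZ hξcl hξne hπ E.J E.b hξdiv ζ C i hζinj hrange hfam
  haveI hint' : ∀ k', IsIntegral (C' k') := fun k' => (hfam' k').2.1
  refine ⟨@familyDelta _ C' (fun k' => (hfam' k').2.1), ⟨_, inferInstance, ζ', C', i', hfam', hinj', hrange', rfl⟩, ?_⟩
  refine familyDelta_lt_of_inl_le C C' (fun k => finsum_pointDelta_ne_top (hCq k) (hCdim k))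
    (fun k => (hδ k (hint' _) (hint k)).1) ⟨k₀, (hδ k₀ (hint' _) (hint k₀)).2 ⟨c₀, rfl, hc₀⟩⟩
    fun s => hδE s (hint' _)

/-! ## Rung (i-h): every standard ideal exponent on a surface is resolved by the permissible calculus -/

/-- The induction on the measure: from every standard surface state carrying a curve family of total `δ`-invariant `n`,
finitely many §2.1-permissible steps reach a resolved state — PHASE 0 (good procrastinations, `Δ` drops) until every
curve of `Sing` is regular, then the honest procedure of rung (i-g). [cite: Kollar2007, §1.4] -/
theorem exists_permissibleReaches_resolved_of_hasCurveFamily {K : Type} [Field K] [CharP K p] [PerfectField K]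
    (n : ℕ∞) : ∀ (A : AmbientDatum p K) (E : IdealExponent A.Z), E.IsStandard → topologicalKrullDim A.Z ≤ 2 →
      HasCurveFamily A.Z E.J n → ∃ (A' : AmbientDatum p K) (E' : IdealExponent A'.Z), PermissibleReaches A E A' E' ∧
        E'.sing = ∅ := by
  induction n using WellFoundedLT.induction with
  | _ n ih =>
  intro A E hE hdimZ hfamily
  obtain ⟨ι, hι, ζ, C, i, hfam, hζinj, hrange, hn⟩ := hfamily
  by_cases hreg : ∀ k, ζ k ∈ E.sing → Scheme.IsRegular (C k)
  · -- every singular curve is regular: the honest procedure resolves (rung (i-g))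
    have hP : Regime.singCurvesRegular A E := singCurvesRegular_of_family A hE hdimZ ζ C i hfam hrange hreg
    obtain ⟨A', E', hreach, hres⟩ := exists_honestReaches_resolved A E hE hdimZ hP
    exact ⟨A', E', PermissibleReaches.of_honestReaches hreach, hres⟩
  · -- a singular curve of `Sing(E)` which is singular somewhere: one good procrastination, then induction
    push Not at hreg
    obtain ⟨k₀, hk₀, hnreg⟩ := hreg
    obtain ⟨c₀, hc₀⟩ : ∃ c₀ : C k₀, c₀ ∉ Scheme.regularLocus (C k₀) := not_forall.mp hnreg
    obtain ⟨A₁, D, π, hD, hhom, hπ, hst, hdim₁, n₁, hfamily₁, hlt⟩ :=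
      exists_goodProcrastination A E hE hdimZ ζ C i hζinj hrange hfam hk₀ hc₀
    rw [hn] at hlt
    obtain ⟨A', E', hreach, hres⟩ := ih n₁ hlt A₁ (E.transform π D) hst hdim₁ hfamily₁
    exact ⟨A', E', PermissibleReaches.head D π hD hhom hπ hreach, hres⟩

/-- [OURS · L1 W4.6 rung (i-h)] NOT a statement of the manuscript. **EVERY STANDARD IDEAL EXPONENT ON A SURFACE OVER A
PERFECT FIELD IS RESOLVED BY THE PERMISSIBLE CALCULUS.** Over a perfect field `K : Type` of characteristic `p`: for a
standard ideal exponent `E₀ = (J, b)` on an ambient datum `A₀` of dimension `≤ 2` — NO hypothesis on `Sing(E₀)` — some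
state `(A, E)` reached from `(A₀, E₀)` by finitely many §2.1-permissible blow-ups (transforms of Def. 2.1; OUR
procedure: good procrastinations at singular points of singular curves of `Sing`, then honest steps) has `Sing(E) = ∅`.
This removes the hypothesis «singular curves regular» of rung (i-g) (`exists_honestReaches_resolved`, p536234) and
replaces the role of the resolution clause of Th. 16.13 p.87 l.26–28 on surfaces by OUR procedure; the LITERAL typed
procedure may instead procrastinate forever (negative half, p475556). [cite: Kollar2007, §1.4, Thm. 1.47]
[cite: Hartshorne1977, Ch. V Thm. 3.9] -/
theorem exists_permissibleReaches_resolved {K : Type} [Field K] [CharP K p] [PerfectField K] (A₀ : AmbientDatum p K)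
    (E₀ : IdealExponent A₀.Z) (hE₀ : E₀.IsStandard) (hdim₀ : Regime.dimLE 2 A₀ E₀) :
    ∃ (A : AmbientDatum p K) (E : IdealExponent A.Z), PermissibleReaches A₀ E₀ A E ∧ E.sing = ∅ := by
  obtain ⟨n, hfamily⟩ := exists_hasCurveFamily A₀ hE₀ hdim₀
  exact exists_permissibleReaches_resolved_of_hasCurveFamily n A₀ E₀ hE₀ hdim₀ hfamily

end CampaignW46

end Summit.ResolutionOfSingularities.ResolutionOfSingularities.Theorems

end
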